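import Summits.QuantumFields.YangMills.Theses.FixedTorusFirst
import Summits.QuantumFields.YangMills.Theorems.UniversalDetectorDetectorExists
import Summits.QuantumFields.YangMills.Theorems.UniversalDetectorBlindRigidity
import Summits.QuantumFields.YangMills.Theorems.FixedTorusFirstCompactDetectorTransfer

/-!
# Route `FixedTorusFirst`, support item `SomeTorusDetector` (stmt-QuantumFields-24177) — FROM the one remaining
analysis stub `BlindSeqExtraction`

Ideator seat ym-idea-8 g11 (LINE g11-2 «engine tori», lens «dual»).  The NT-side skeleton `Cruxes/NT/Lines/engine_tori.lean`
(rev 4) proves `someTorusDetector_of : BlindSeqExtraction → BlindDetectorRigidity → CompactDetectorTransfer → SomeTorusDetector`;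
two of the three obligations are LANDED — `Cruxes.BlindDetectorRigidity.blindDetectorRigidity` (seat w4, ✓p705845) and
`Cruxes.FixedTorusFirstEngineTori.fixedTorusFirst_compactDetectorTransfer` (this seat, ✓p707314).  This module is the
composition Theorems-side with both plugged in:

  `someTorusDetector_of_blindSeqExtraction (hX : <BlindSeqExtraction, verbatim>) : FixedTorusFirst.SomeTorusDetector`,

so the item closes by a three-line file once the extraction lands (★ ym-spine-19353-p1; the SAME stub closes
`UniversalDetector.BlindDetector`, module `UniversalDetectorBlindDetectorOfExtraction`).

Proof.  Step A — Gaussian floors ALONG THE ENGINE TORI by contradiction: a sequence `β_k ≥ k` with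
`Q2_{β_k, Lsel β_k}(ϑv₀, v₀) < 1/(k+1)` (universal detector `v₀`), the torus ceilings `BDD6_T`/`LONG6_T` holding eventually
because they hold for all late `β`, the blind extraction `hX` along `(β_k, Lsel β_k)`, `∫∫ ϑv₀ v₀ K = 0` by RP, blind rigidity,
contradiction with NONCONTACT_{Ω,T}.  Step B — the compact-support transfer at cost `ε₀/2` and the witness `L := Lsel β`.

No summit, rung or crux is proved here: `SomeTorusDetector` still needs `BlindSeqExtraction` (XL), and `NT` stays open behind
`SomeTorusEdgeBit`, `SkewOnSomeTorus`, `FiniteSizeInsensitivity`.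
-/

set_option autoImplicit false

namespace Summit.QuantumFields.YangMills.Cruxes.FixedTorusFirstEngineTori

open Summit.QuantumFields.YangMills.Theses.FixedTorusFirst
open MeasureTheory Literature.MathematicalPhysics.QuantumFieldTheory Literature.MathematicalPhysics.QuantumLattice
  Literature.Probability.LatticeModels Summit.QuantumFields.YangMills.Cruxes.OSLegsFromFemtoAndGap.DlrCollarTransfer

/-- **`BlindSeqExtraction → SomeTorusDetector`** (item stmt-QuantumFields-24177 from its one remaining stub). -/
theorem someTorusDetector_of_blindSeqExtraction
    (hX : open MeasureTheory Literature.MathematicalPhysics.QuantumFieldTheory Literature.MathematicalPhysics.QuantumLattice Literature.Probability.LatticeModels Summit.QuantumFields.YangMills.Cruxes.OSLegsFromFemtoAndGap.DlrCollarTransfer in ∀ (G : Type) [Group G] [TopologicalSpace G] [IsTopologicalGroup G] [CompactSpace G], IsCompactSimpleLieGroup G → letI : MeasurableSpace G := borel G; haveI : BorelSpace G := ⟨rfl⟩; ∀ (r : LatticeRep G) (a : ℝ → ℝ), (∀ β, 0 < a β) → Filter.Tendsto a Filter.atTop (nhds 0) → let ker : ℝ → ℕ → (Fin 4 → ℤ)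 → ℝ := (fun (β : ℝ) (L : ℕ) (z : Fin 4 → ℤ) => (a β)⁻¹ ^ 8 * (torusE G r β L (fun U => dens G r 0 U * dens G r z U) - torusE G r β L (dens G r 0) * torusE G r β L (dens G r z))); let ker6 : ℝ → ℕ → Fin 4 × Fin 4 → Fin 4 × Fin 4 → (Fin 4 → ℤ) → ℝ := (fun (β : ℝ) (L : ℕ) (p q : Fin 4 × Fin 4) (z : Fin 4 → ℤ) => (a β)⁻¹ ^ 8 * (torusE G r β L (fun U => plane G r p 0 U * plane G r q z U) - torusE G r β L (plane G r p 0) * torusE G r β L (plane G r q z))); ∀ (βs : ℕ → ℝ) (Ls : ℕ → ℕ), Filter.Tendsto βs Filter.atTop Filter.atTop → Filter.Tendsto (fun k => a (βs k) * Ls k) Filter.atTop Filter.atTop → (∀ p q : Fin 4 × Fin 4, p.1 < p.2 → q.1 < q.2 → ∀ η : ℝ, 0 < η → ∃ C : ℝ, ∃ k₀ : ℕ, ∀ m : ℕ, k₀ ≤ m → ∀ z ∈ box 4 (Ls m), η ≤ ‖a (βs m) • siteToE z‖ → |ker6 (βs m) (Ls m) p q z| ≤ C) → (∀ p q : Fin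 4 × Fin 4, p.1 < p.2 → q.1 < q.2 → ∀ η : ℝ, 0 < η → ∀ τ : ℝ, 0 < τ → ∃ Λ : ℝ, ∃ k₀ : ℕ, ∀ m : ℕ, k₀ ≤ m → ∀ (k : Fin 4) (z : Fin 4 → ℤ) (n : ℕ), (∀ j : ℕ, j ≤ n → z + Pi.single k (j : ℤ) ∈ box 4 (Ls m) ∧ η ≤ ‖a (βs m) • siteToE (z + Pi.single k (j : ℤ))‖ ∧ τ ≤ |a (βs m) * (z k + j)|) → |ker6 (βs m) (Ls m) p q z - ker6 (βs m) (Ls m) p q (z + Pi.single k (n : ℤ))| ≤ Λ * (a (βs m) * n)) → ∃ (φ : ℕ → ℕ) (K : EuclideanSpace ℝ (Fin 4) → ℝ), StrictMono φ ∧ (∀ η ε : ℝ, 0 < η → 0 < ε → ∃ k₀ : ℕ, ∀ k : ℕ, k₀ ≤ k → ∀ z ∈ box 4 (Ls (φ k)), (∀ i : Fin 4, η ≤ |a (βs (φ k)) * (z i : ℝ)|) → ‖a (βs (φ k)) • siteToE z‖ ≤ η⁻¹ → |ker (βs (φ k)) (Ls (φ k)) z - K (a (βs (φ k)) • siteToE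 z)| ≤ ε) ∧ Measurable K ∧ ContinuousOn K {z | ∀ i : Fin 4, z i ≠ 0} ∧ (∀ η : ℝ, 0 < η → ∃ C : ℝ, ∀ z : EuclideanSpace ℝ (Fin 4), η ≤ ‖z‖ → |K z| ≤ C) ∧ (∀ z : EuclideanSpace ℝ (Fin 4), K (-z) = K z) ∧ (∀ z : EuclideanSpace ℝ (Fin 4), K (timeReflection 4 z) = K z) ∧ (∀ (w : SchwartzMap (EuclideanSpace ℝ (Fin 4)) ℝ) (t₀ T : ℝ), 0 < t₀ → tsupport (w : EuclideanSpace ℝ (Fin 4) → ℝ) ⊆ {y | t₀ ≤ y 0 ∧ y 0 ≤ T} → 0 ≤ ∫ x, ∫ y, (thetaTest 4 w) x * w y * K (y - x)) ∧ (∀ (w₁ w₂ : SchwartzMap (EuclideanSpace ℝ (Fin 4)) ℝ) (t₀ T : ℝ), 0 < t₀ → tsupport (w₁ : EuclideanSpace ℝ (Fin 4) → ℝ) ⊆ {y | t₀ ≤ -(y 0) ∧ -(y 0) ≤ T} → tsupport (w₂ : EuclideanSpace ℝ (Fin 4) → ℝ) ⊆ {y | t₀ ≤ y 0 ∧ y 0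 ≤ T} → Filter.Tendsto (fun k => Q2 G r (βs (φ k)) (Ls (φ k)) (a (βs (φ k))) w₁ w₂) Filter.atTop (nhds (∫ x, ∫ y, w₁ x * w₂ y * K (y - x))))) :
    Summit.QuantumFields.YangMills.Theses.FixedTorusFirst.SomeTorusDetector := by
  intro G _ _ _ _ hG r a Lsel ha hlim hgrow ker ker6 hBdd hLong hN
  letI : MeasurableSpace G := borel G
  haveI : BorelSpace G := ⟨rfl⟩
  obtain ⟨v₀, h, ta, tb, hta, hhc, hh0, hhsupp, hhne, hv₀, hsuppv, hsuppθ⟩ :=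
    Summit.QuantumFields.YangMills.Theorems.universalDetector_detectorExists
  -- Step A: a uniform Gaussian floor along the engine tori
  have hfloor : ∃ ε₀ : ℝ, 0 < ε₀ ∧ ∃ β₆ : ℝ, ∀ β : ℝ, β₆ ≤ β →
      ε₀ ≤ Q2 G r β (Lsel β) (a β) (thetaTest 4 v₀) v₀ := by
    by_contra hcon
    push Not at hcon
    choose βs hβs hQs using fun k : ℕ => hcon (1 / ((k : ℝ) + 1)) (by positivity) k
    have hβs' : Filter.Tendsto βs Filter.atTop Filter.atTop :=
      Filter.tendsto_atTop_mono hβs tendsto_natCast_atTop_atTop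
    have haL' : Filter.Tendsto (fun k => a (βs k) * ((fun k => Lsel (βs k)) k : ℝ)) Filter.atTop Filter.atTop :=
      hgrow.comp hβs'
    have hev : ∀ β₅ : ℝ, ∃ k₀ : ℕ, ∀ m : ℕ, k₀ ≤ m → β₅ ≤ βs m := fun β₅ =>
      Filter.eventually_atTop.1 (hβs'.eventually_ge_atTop β₅)
    have hBdd' : ∀ p q : Fin 4 × Fin 4, p.1 < p.2 → q.1 < q.2 → ∀ η : ℝ, 0 < η → ∃ C : ℝ, ∃ k₀ : ℕ, ∀ m : ℕ, k₀ ≤ m → ∀ z ∈ box 4 ((fun k => Lsel (βs k)) m), η ≤ ‖a (βs m) • siteToE z‖ → |ker6 (βs m) ((fun k => Lsel (βs k)) m) p q z| ≤ C := by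
      intro p q hp hq η hη
      obtain ⟨C, β₅, hC⟩ := hBdd p q hp hq η hη
      obtain ⟨k₀, hk₀⟩ := hev β₅
      exact ⟨C, k₀, fun m hm z hz hηz => hC (βs m) (hk₀ m hm) z hz hηz⟩
    have hLong' : ∀ p q : Fin 4 × Fin 4, p.1 < p.2 → q.1 < q.2 → ∀ η : ℝ, 0 < η → ∀ τ : ℝ, 0 < τ → ∃ Λ : ℝ, ∃ k₀ : ℕ, ∀ m : ℕ, k₀ ≤ m → ∀ (k : Fin 4) (z : Fin 4 → ℤ) (n : ℕ), (∀ j : ℕ, j ≤ n → z + Pi.single k (j : ℤ) ∈ box 4 ((fun k => Lsel (βs k)) m) ∧ η ≤ ‖a (βs m) • siteToE (z + Pi.single k (j : ℤ))‖ ∧ τ ≤ |a (βs m) * (z k + j)|) → |ker6 (βs m) ((fun k => Lsel (βs k)) m) p q z - ker6 (βs m) ((fun k => Lsel (βs k)) m) p q (z + Pi.single k (n : ℤ))| ≤ Λ * (a (βs m) * n) := by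
      intro p q hp hq η hη τ hτ
      obtain ⟨Λ, β₅, hΛ⟩ := hLong p q hp hq η hη τ hτ
      obtain ⟨k₀, hk₀⟩ := hev β₅
      exact ⟨Λ, k₀, fun m hm k z n hzn => hΛ (βs m) (hk₀ m hm) k z n hzn⟩
    obtain ⟨φ, K, hφ, hconv, hKm, hKc, hKb, hKe, hKθ, hRP, hQ2lim⟩ :=
      hX G hG r a ha hlim βs (fun k => Lsel (βs k)) hβs' haL' hBdd' hLong'
    have hlimQ := hQ2lim _ v₀ ta tb hta hsuppθ hsuppv
    have hg0 : Filter.Tendsto (fun k => 1 / ((φ k : ℝ) + 1)) Filter.atTop (nhds 0) :=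
      tendsto_one_div_add_atTop_nhds_zero_nat.comp hφ.tendsto_atTop
    have hIle := le_of_tendsto_of_tendsto hlimQ hg0 (Filter.Eventually.of_forall fun k => (hQs (φ k)).le)
    have hI0 := le_antisymm hIle (hRP v₀ ta tb hta hsuppv)
    have hK0 : ∀ z : EuclideanSpace ℝ (Fin 4), (∀ i : Fin 4, z i ≠ 0) → K z = 0 :=
      Summit.QuantumFields.YangMills.Cruxes.BlindDetectorRigidity.blindDetectorRigidity K h ta tb v₀ hKm hKc hKb hKe hKθ hRP
        hta hhc hh0 hhsupp hhne hv₀ hI0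
    obtain ⟨z, hz, hKz⟩ := hN (fun k => βs (φ k)) K (hβs'.comp hφ.tendsto_atTop) hconv
    exact hKz (hK0 z hz)
  -- Step B: compact-support transfer and the witness `L := Lsel β`
  obtain ⟨ε₀, hε₀, β₆, hfl⟩ := hfloor
  obtain ⟨v, β₇, hvc, hvsupp, hvQ⟩ :=
    fixedTorusFirst_compactDetectorTransfer G hG r a Lsel ha hlim hgrow hBdd v₀ ta tb hta hsuppv hsuppθ (ε₀ / 2)
      (by positivity)
  refine ⟨v, ε₀ / 2, 0, fun y hy => lt_of_lt_of_le hta (hvsupp hy).1, hvc, by positivity, fun Λ _ => ?_⟩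
  obtain ⟨βg, hβg⟩ := Filter.eventually_atTop.1 (hgrow.eventually_ge_atTop Λ)
  refine ⟨max (max β₆ β₇) βg, fun β hβ => ⟨Lsel β, hβg β (le_of_max_le_right hβ), ?_⟩⟩
  have h1 := hfl β (le_trans (le_max_left _ _) (le_of_max_le_left hβ))
  have h2 := hvQ β (le_trans (le_max_right _ _) (le_of_max_le_left hβ))
  have h3 := (abs_le.1 h2).1
  linarith

end Summit.QuantumFields.YangMills.Cruxes.FixedTorusFirstEngineTori
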